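import Mathlib
import Literature.NumberTheory.GaloisRepresentations.ToLocalRestrictField
import Literature.NumberTheory.GaloisRepresentations.RestrictFieldSelf
import Literature.NumberTheory.GaloisRepresentations.AbsGaloisOuterConj
import Literature.NumberTheory.GaloisRepresentations.PadicAlgebraDegreeOnePlace
import Literature.NumberTheory.Automorphic.GaloisActionPlaces
import Literature.NumberTheory.PAdicHodge.FontaineDpst
import HarnessLib

/-!
# Plumbing for stub `stub_tensorInductionLocal` (re-typed (2a)
# `stub_tensorLocalCrystalline_of_schemata`) of line `merged`, crux `TensorSquareParallel`
# (stmt-Langlands-17009)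

Number-field / local-field plumbing (theorems only, no definition, no named fact) used to localise
Calegari's tensor induction `ψ = ⊗-Ind_{Γ_F}^{Γ_ℚ} ρ` at the prime `p`, i.e. to express
`ψ|_{Γ_{ℚ_v}}` (`v` the place of `ℚ` above a prime `p` SPLIT in the imaginary quadratic `F`)
through `ρ|_{Γ_{F_{v₀}}}` and `ρ|_{Γ_{F_{w₀}}}` at the two places `v₀ ≠ w₀ = ḡ • v₀` of `F` above
`p`, up to changes of frame and transport along continuous isomorphisms of the completions:

* `exists_absGaloisOuterConj_absGaloisRestrict_eq_conj` — **the outer action moves decomposition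
  groups**: for a Galois extension of number fields `M/F₀`, `τ ∈ Γ_{F₀}` with image
  `ḡ ∈ Gal(M/F₀)` and places `w`, `v = ḡ⁻¹ • w` of `M`, the composite
  `Γ_{M_v} → Γ_M →θ_τ Γ_M` of the restriction to the decomposition group at `v` with the outer
  automorphism `θ_τ = absGaloisOuterConj F₀ M τ` is, up to an inner automorphism of `Γ_M`, the
  restriction `Γ_{M_v} → Γ_{M_w} → Γ_M` along the continuous isomorphism
  `ḡ⁻¹ : M_w ≅ M_v` of completions (`galAdicCompletionMap`, file `Automorphic/GaloisActionPlaces`)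
  (Neukirch, ANT Ch. I §9: `τ G_𝔓 τ⁻¹ = G_{τ𝔓}`; Serre 1968 Ch. I §2.1: restriction to a
  decomposition group is well defined up to conjugation).  Proof: restriction maps attached to two
  `M`-embeddings `M̄ → \\overline{M_v}` are conjugate (`absGaloisRestrict_isConj_of_algHom_holds`),
  applied to the twisted embedding `ι_{ḡ⁻¹} ∘ ι_w ∘ ι ∘ τ ∘ ι⁻¹`, which IS `M`-linear.
  Corollary `exists_toLocal_comp_absGaloisOuterConj_eq_conj`:
  `(ρ ∘ θ_τ)|_{Γ_{M_v}} = ρ(δ) · (ρ|_{Γ_{M_w}} ∘ res_{M_w → M_v}) · ρ(δ)⁻¹`.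
* `exists_comp_absGaloisRestrict_comp_absGaloisRestrict_eq_conj` — restriction along `K → L → K`
  with composite the identity is a change of frame (`SorensenPatching` transitivity +
  `RestrictFieldSelf`).
* `continuous_symm_adicCompletionOfLiesOver_of_degree_one` — at a place of degree one the local
  base-change isomorphism `F_v ≅ K_w` (`surjective_adicCompletionOfLiesOver`) has a CONTINUOUS
  inverse (it preserves valuations).
* `exists_algHom_toRingHom_eq_comp` — a label `τ'' : L →ₐ[ℚ_ℓ] ℚ̄_ℓ` (pinned = canonical
  `ℚ_ℓ`-structure of `fontainePst L ℓ hL`) restricts along a CONTINUOUS `K → L` to a label of `K`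
  for the pinned structure of `fontainePst K ℓ hK` (continuous ring maps `ℚ_ℓ → L` are unique,
  `LocalField.eq_padicRingHom_of_continuous`).
* `nodup_and_card_pairSum`, `eq_of_ne_one_of_card_eq_two` — arithmetic of the pairwise-sum
  multiset `{a+a', a+b', b+a', b+b'}`, and a one-line fact on groups of order two.

Everything is proved; axioms ⊆ {propext, Classical.choice, Quot.sound}.

References: [NeukirchANT1999] J. Neukirch, *Algebraic Number Theory* (1999), Ch. I §9 (conjugate
primes, `G_{σ𝔓} = σ G_𝔓 σ⁻¹`), Ch. II §8; [SerreAbelianLadic1968] J.-P. Serre, *Abelian ℓ-adic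
representations and elliptic curves* (1968), Ch. I §2.1; [CasselsFrohlichANT1967] Cassels–Fröhlich,
Ch. VII §1.1 (`σ_w : L_w ≅ L_{σ w}`); [MilneFT2022] J. S. Milne, *Fields and Galois Theory*, Ch. 7.
-/

noncomputable section

-- project-wide option (lakefile weak.linter.dupNamespace); `Summit.Langlands.Langlands` is mandated
set_option linter.dupNamespace false

open scoped NumberField
open IsDedekindDomain Field ValuativeRel
open Literature.NumberTheory.GaloisRepresentations Literature.NumberTheory.Automorphic
  Literature.NumberTheory.PAdicHodge

namespace Summit.Langlands.Langlands.Theorems.TensorSquareParallel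

/-! ### The outer action of `Γ_{F₀}` moves the decomposition groups of `Γ_M` -/

section OuterConjLocal

variable {F₀ M : Type} [Field F₀] [Field M] [NumberField M] [Algebra F₀ M] [IsGalois F₀ M]

/-- **The outer action moves decomposition groups.**  Let `M/F₀` be a Galois extension of number
fields, `τ ∈ Γ_{F₀}` with image `ḡ = τ̄ ∈ Gal(M/F₀)` (`absGaloisQuot`), and `w`, `v = ḡ⁻¹ • w`
places of `M`; give `M_v` the `M_w`-algebra structure of the continuous isomorphism
`ḡ⁻¹ : M_w → M_v` (`galAdicCompletionMap`).  Then for some `δ ∈ Γ_M` and all `σ ∈ Γ_{M_v}`,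
`θ_τ(res_v σ) = δ · res_w(res_{M_w → M_v} σ) · δ⁻¹`: the outer automorphism `θ_τ` carries the
decomposition group at `v` onto (a conjugate of) the decomposition group at `ḡ • v = w`,
compatibly with `ḡ⁻¹ : M_w ≅ M_v` ("`G_{τ𝔓} = τ G_𝔓 τ⁻¹`").  Proof: the map
`σ ↦ θ_{τ⁻¹}(res_w(res_{M_w → M_v} σ))` is compatible with the `M`-embedding
`ι' = ι_{ḡ⁻¹} ∘ ι_w ∘ ι ∘ τ ∘ ι⁻¹ : M̄ → \\overline{M_v}` (the twist by `τ` exactly undoes the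
`ḡ⁻¹`-semilinearity), hence conjugate to `res_v` (`absGaloisRestrict_isConj_of_algHom_holds`).
[cite: NeukirchANT1999, Ch. I §9 (9.1)–(9.4)] [cite: SerreAbelianLadic1968, Ch. I §2.1] -/
theorem exists_absGaloisOuterConj_absGaloisRestrict_eq_conj (τ : absoluteGaloisGroup F₀)
    {v w : HeightOneSpectrum (𝓞 M)} (h : (absGaloisQuot F₀ M τ)⁻¹ • w = v) :
    letI := (galAdicCompletionMap (L := M) (absGaloisQuot F₀ M τ)⁻¹ h).toAlgebra
    ∃ δ : absoluteGaloisGroup M, ∀ σ : absoluteGaloisGroup (v.adicCompletion M),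
      absGaloisOuterConj F₀ M τ (absGaloisRestrict M (v.adicCompletion M) σ) =
        δ * absGaloisRestrict M (w.adicCompletion M)
          (absGaloisRestrict (w.adicCompletion M) (v.adicCompletion M) σ) * δ⁻¹ := by
  set g : M ≃ₐ[F₀] M := absGaloisQuot F₀ M τ with hg
  set gw : w.adicCompletion M →+* v.adicCompletion M := galAdicCompletionMap (L := M) g⁻¹ h
    with hgw
  letI : Algebra (w.adicCompletion M) (v.adicCompletion M) := gw.toAlgebra
  -- the players
  set ι : AlgebraicClosure F₀ ≃ₐ[F₀] AlgebraicClosure M := absClosureEquiv F₀ M with hι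
  set ιw : AlgebraicClosure M →ₐ[M] AlgebraicClosure (w.adicCompletion M) :=
    absClosureEmbedding M (w.adicCompletion M) with hιw
  set ιg : AlgebraicClosure (w.adicCompletion M) →ₐ[w.adicCompletion M]
      AlgebraicClosure (v.adicCompletion M) :=
    absClosureEmbedding (w.adicCompletion M) (v.adicCompletion M) with hιg
  -- the twisted embedding `f : M̄ → Ω`, `f y = ιg (ιw (ι (τ • ι⁻¹ y)))`
  let f : AlgebraicClosure M → AlgebraicClosure (v.adicCompletion M) :=
    fun y => ιg (ιw (ι (τ • ι.symm y)))
  have hf1 : f 1 = 1 := by simp [f]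
  have hfmul : ∀ x y, f (x * y) = f x * f y := by intro x y; simp [f, smul_mul']
  have hf0 : f 0 = 0 := by simp [f]
  have hfadd : ∀ x y, f (x + y) = f x + f y := by intro x y; simp [f, smul_add]
  let fh : AlgebraicClosure M →+* AlgebraicClosure (v.adicCompletion M) :=
    { toFun := f, map_one' := hf1, map_mul' := hfmul, map_zero' := hf0, map_add' := hfadd }
  -- `f` is `M`-linear: `ι (τ • e y) = ḡ y` and `ḡ⁻¹ (ḡ y) = y`
  have hfM : ∀ y : M, f (algebraMap M (AlgebraicClosure M) y) =
      algebraMap M (AlgebraicClosure (v.adicCompletion M)) y := by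
    intro y
    have h1 : ι.symm (algebraMap M (AlgebraicClosure M) y) = absEmbedding F₀ M y := rfl
    have h2 : τ • absEmbedding F₀ M y = absEmbedding F₀ M (g y) :=
      (absEmbedding_absGaloisQuot_apply F₀ M τ y).symm
    have h3 : ι (absEmbedding F₀ M (g y)) = algebraMap M (AlgebraicClosure M) (g y) :=
      absClosureEmbedding_absEmbedding F₀ M (g y)
    change ιg (ιw (ι (τ • ι.symm (algebraMap M (AlgebraicClosure M) y)))) = _
    rw [h1, h2, h3, ιw.commutes, IsScalarTower.algebraMap_apply M (w.adicCompletion M)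
      (AlgebraicClosure (w.adicCompletion M)), ιg.commutes,
      IsScalarTower.algebraMap_apply (w.adicCompletion M) (v.adicCompletion M)
      (AlgebraicClosure (v.adicCompletion M)), RingHom.algebraMap_toAlgebra,
      IsScalarTower.algebraMap_apply M (v.adicCompletion M)
        (AlgebraicClosure (v.adicCompletion M))]
    congr 1
    have h4 : gw ((g y : M) : w.adicCompletion M) = ((g⁻¹ (g y) : M) : v.adicCompletion M) := by
      rw [hgw]; exact galAdicCompletionMap_coe_algEquiv F₀ g⁻¹ h (g y)
    have h5 : g⁻¹ (g y) = y := by rw [AlgEquiv.aut_inv, AlgEquiv.symm_apply_apply]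
    rw [h5] at h4
    exact h4
  let ι' : AlgebraicClosure M →ₐ[M] AlgebraicClosure (v.adicCompletion M) :=
    { fh with commutes' := hfM }
  have hι' : ∀ x : AlgebraicClosure F₀, ι' (ι x) = ιg (ιw (ι (τ • x))) := by
    intro x
    change ιg (ιw (ι (τ • ι.symm (ι x)))) = _
    rw [AlgEquiv.symm_apply_apply]
  -- the competing restriction map `r' = θ_{τ⁻¹} ∘ res_w ∘ res_{M_w → M_v}`
  let r' : absoluteGaloisGroup (v.adicCompletion M) → absoluteGaloisGroup M := fun σ =>
    absGaloisOuterConj F₀ M τ⁻¹ (absGaloisRestrict M (w.adicCompletion M)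
      (absGaloisRestrict (w.adicCompletion M) (v.adicCompletion M) σ))
  have hr' : ∀ (σ : absoluteGaloisGroup (v.adicCompletion M)) (z : AlgebraicClosure M),
      ι' (r' σ • z) = σ • ι' z := by
    intro σ z
    obtain ⟨x, rfl⟩ := ι.surjective z
    set y := absGaloisRestrict M (w.adicCompletion M)
      (absGaloisRestrict (w.adicCompletion M) (v.adicCompletion M) σ) with hy
    have h1 : r' σ • ι x = ι (absGaloisRestrict F₀ M (r' σ) • x) :=
      (absGaloisRestrict_apply_smul F₀ M (r' σ) x).symm
    have h2 : absGaloisRestrict F₀ M (r' σ) = τ⁻¹ * absGaloisRestrict F₀ M y * τ⁻¹⁻¹ :=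
      absGaloisRestrict_absGaloisOuterConj F₀ M τ⁻¹ y
    rw [h1, hι', hι', h2, inv_inv, ← mul_smul, ← mul_assoc, ← mul_assoc, mul_inv_cancel, one_mul,
      mul_smul]
    change ιg (ιw (absClosureEmbedding F₀ M (absGaloisRestrict F₀ M y • τ • x))) =
      σ • ιg (ιw (absClosureEmbedding F₀ M (τ • x)))
    rw [hy, absGaloisRestrict_apply_smul, hιw, absGaloisRestrict_apply_smul, hιg,
      absGaloisRestrict_apply_smul]
  obtain ⟨t, ht⟩ := absGaloisRestrict_isConj_of_algHom_holds M (v.adicCompletion M) ι' r' hr'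
  refine ⟨(absGaloisOuterConj F₀ M τ t)⁻¹, fun σ => ?_⟩
  have key := congrArg (absGaloisOuterConj F₀ M τ) (ht σ)
  simp only [r', absGaloisOuterConj_apply_inv_apply, map_mul, map_inv] at key
  rw [key]
  group

/-- **Localising a conjugate representation**: with `M/F₀` Galois, `τ ∈ Γ_{F₀}`, `ḡ = τ̄` and
`v = ḡ⁻¹ • w`, the restriction of `ρ^τ = ρ ∘ θ_τ` to `Γ_{M_v}` is a change of frame of the
restriction of `ρ|_{Γ_{M_w}}` along the continuous isomorphism `ḡ⁻¹ : M_w ≅ M_v`: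
`(ρ ∘ θ_τ)|_{Γ_{M_v}} = ρ(δ) · (ρ|_{Γ_{M_w}} ∘ res_{M_w → M_v}) · ρ(δ)⁻¹`.
[cite: SerreAbelianLadic1968, Ch. I §2.1] [cite: NeukirchANT1999, Ch. I §9 (9.4)] -/
theorem exists_toLocal_comp_absGaloisOuterConj_eq_conj {A : Type*} [CommRing A]
    [TopologicalSpace A] [IsTopologicalRing A] {n : ℕ} (τ : absoluteGaloisGroup F₀)
    (ρ : FramedGaloisRep M A n) {v w : HeightOneSpectrum (𝓞 M)}
    (h : (absGaloisQuot F₀ M τ)⁻¹ • w = v) :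
    letI := (galAdicCompletionMap (L := M) (absGaloisQuot F₀ M τ)⁻¹ h).toAlgebra
    ∃ δ : absoluteGaloisGroup M,
      FramedGaloisRep.toLocal v (ρ.comp (absGaloisOuterConj F₀ M τ)) =
        FramedRep.conj (ρ δ) ((ρ.toLocal w).comp
          (absGaloisRestrict (w.adicCompletion M) (v.adicCompletion M))) := by
  letI := (galAdicCompletionMap (L := M) (absGaloisQuot F₀ M τ)⁻¹ h).toAlgebra
  obtain ⟨δ, hδ⟩ := exists_absGaloisOuterConj_absGaloisRestrict_eq_conj (F₀ := F₀) τ h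
  exact ⟨δ, FramedRep.comp_eq_conj_of_forall_eq ρ
    (f₁ := (absGaloisOuterConj F₀ M τ).comp (absGaloisRestrict M (v.adicCompletion M)))
    (f₂ := (absGaloisRestrict M (w.adicCompletion M)).comp
      (absGaloisRestrict (w.adicCompletion M) (v.adicCompletion M))) hδ⟩

end OuterConjLocal

/-! ### Restriction along `K → L → K` (composite the identity) is a change of frame -/

section RestrictSelf

variable {K L : Type} [Field K] [Field L] [Algebra K L] [Algebra L K] [IsScalarTower K L K]
  {A : Type*} [CommRing A] [TopologicalSpace A] [IsTopologicalRing A] {n : ℕ}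

/-- For algebra structures `K → L → K` composing to the identity (e.g. a field isomorphism and its
inverse), `(ρ ∘ res_{K→L}) ∘ res_{L→K} = ρ(t) ρ ρ(t)⁻¹` for some `t ∈ Γ_K` (transitivity of
restriction up to conjugacy, `SorensenPatching.exists_absGaloisRestrict_absGaloisRestrict_eq_conj`,
and `absGaloisRestrict K K` is inner, `exists_absGaloisRestrict_self_eq_conj`).
[cite: MilneFT2022, Ch. 7 (the absolute Galois group)] [cite: SerreAbelianLadic1968, Ch. I §2.1] -/
theorem exists_comp_absGaloisRestrict_comp_absGaloisRestrict_eq_conj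
    (ρ : FramedRep (absoluteGaloisGroup K) A n) :
    ∃ t : absoluteGaloisGroup K,
      (ρ.comp (absGaloisRestrict K L)).comp (absGaloisRestrict L K) = FramedRep.conj (ρ t) ρ := by
  obtain ⟨τ, hτ⟩ := SorensenPatching.exists_absGaloisRestrict_absGaloisRestrict_eq_conj K L K
  obtain ⟨σ₀, hσ₀⟩ := exists_absGaloisRestrict_self_eq_conj (K := K)
  refine ⟨τ * σ₀⁻¹, ?_⟩
  refine FramedRep.comp_eq_conj_of_forall_eq ρ
    (f₁ := (absGaloisRestrict K L).comp (absGaloisRestrict L K))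
    (f₂ := ContinuousMonoidHom.id _) (τ := τ * σ₀⁻¹) fun σ => ?_
  change absGaloisRestrict K L (absGaloisRestrict L K σ) = τ * σ₀⁻¹ * σ * (τ * σ₀⁻¹)⁻¹
  rw [hτ σ, hσ₀ σ]
  group

end RestrictSelf

/-! ### Degree-one places: the local base change is a continuous isomorphism both ways -/

section DegreeOne

variable {F K : Type} [Field F] [NumberField F] [Field K] [NumberField K] [Algebra F K]
  (v : HeightOneSpectrum (𝓞 F)) (w : HeightOneSpectrum (𝓞 K)) [w.asIdeal.LiesOver v.asIdeal]

/-- At a place `w ∣ v` with `e(w|v) = f(w|v) = 1` the local base-change map `F_v → K_w` is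
bijective (`surjective_adicCompletionOfLiesOver`). [cite: NeukirchANT1999, Ch. II §8 (8.2)] -/
theorem bijective_adicCompletionOfLiesOver_of_degree_one
    (he : w.asIdeal.ramificationIdx (𝓞 F) = 1) (hf : w.asIdeal.inertiaDeg (𝓞 F) = 1) :
    Function.Bijective (adicCompletionOfLiesOver F K v w) :=
  ⟨(adicCompletionOfLiesOver F K v w).injective, surjective_adicCompletionOfLiesOver F K v w he hf⟩

/-- **The inverse `K_w → F_v` of the degree-one isomorphism is continuous**: `F_v → K_w` preserves
valuations when `e(w|v) = 1` (`valued_adicCompletionOfLiesOver_of_ramificationIdx_eq_one`), hence so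
does its inverse, and a valuation-preserving ring map is uniformly continuous
(`uniformContinuous_of_map_valuation_eq`). [cite: CasselsFrohlichANT1967, Ch. II §10] -/
theorem continuous_symm_adicCompletionOfLiesOver_of_degree_one
    (he : w.asIdeal.ramificationIdx (𝓞 F) = 1) (hf : w.asIdeal.inertiaDeg (𝓞 F) = 1) :
    Continuous (RingEquiv.ofBijective (adicCompletionOfLiesOver F K v w)
      (bijective_adicCompletionOfLiesOver_of_degree_one v w he hf)).symm := by
  set α := RingEquiv.ofBijective (adicCompletionOfLiesOver F K v w)
      (bijective_adicCompletionOfLiesOver_of_degree_one v w he hf) with hα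
  refine (uniformContinuous_of_map_valuation_eq α.symm.toRingHom (fun x => ?_)
    (HeightOneSpectrum.valuedAdicCompletion_surjective K w)).continuous
  have h1 := valued_adicCompletionOfLiesOver_of_ramificationIdx_eq_one F K v w he (α.symm x)
  have h2 : adicCompletionOfLiesOver F K v w (α.symm x) = x := α.apply_symm_apply x
  rw [h2] at h1
  exact h1.symm

end DegreeOne

/-! ### Labels restrict along continuous maps of `ℓ`-adic fields (pinned `ℚ_ℓ`-structures) -/

section Labels

variable {ℓ : ℕ} [Fact ℓ.Prime] {K L : Type} [Field K] [ValuativeRel K] [TopologicalSpace K]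
  [IsNonarchimedeanLocalField K] [CharZero K] [Field L] [ValuativeRel L] [TopologicalSpace L]
  [IsNonarchimedeanLocalField L] [CharZero L] [Algebra K L]

/-- The structure map `ℚ_ℓ → K` of THE pinned datum `fontainePst K ℓ hK` is the canonical
`padicRingHom` (`fontainePst_algebra_eq_padicAlgebra`, unconditionally). [folklore] -/
theorem algebraMap_fontainePst_eq_padicRingHom (hK : valuation K (ℓ : K) < 1) :
    @algebraMap ℚ_[ℓ] K _ _ (fontainePst K ℓ hK).algebra = LocalField.padicRingHom K ℓ hK := by
  rw [fontainePst_algebra_eq_padicAlgebra]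
  rfl

/-- **A continuous `K → L` intertwines the pinned `ℚ_ℓ`-structures** of `fontainePst K ℓ hK` and
`fontainePst L ℓ hL`: `(K → L) ∘ (ℚ_ℓ → K) = (ℚ_ℓ → L)`, because a continuous ring homomorphism
`ℚ_ℓ → L` is unique (`LocalField.eq_padicRingHom_of_continuous`).
[cite: SerreLocalFields1979, Ch. II §5] -/
theorem algebraMap_comp_algebraMap_fontainePst (hc : Continuous (algebraMap K L))
    (hK : valuation K (ℓ : K) < 1) (hL : valuation L (ℓ : L) < 1) :
    (algebraMap K L).comp (@algebraMap ℚ_[ℓ] K _ _ (fontainePst K ℓ hK).algebra) =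
      @algebraMap ℚ_[ℓ] L _ _ (fontainePst L ℓ hL).algebra := by
  rw [algebraMap_fontainePst_eq_padicRingHom, algebraMap_fontainePst_eq_padicRingHom]
  exact LocalField.eq_padicRingHom_of_continuous L ℓ hL _
    (hc.comp (LocalField.continuous_padicRingHom K ℓ hK))

/-- **Labels restrict along a continuous `K → L`**: for a label `τ'' : L →ₐ[ℚ_ℓ] ℚ̄_ℓ` of `L`
(pinned structure of `fontainePst L ℓ hL`) there is a label `τ'` of `K` (pinned structure of
`fontainePst K ℓ hK`) whose underlying ring homomorphism is `τ'' ∘ (K → L)`. [folklore] -/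
theorem exists_algHom_toRingHom_eq_comp (hc : Continuous (algebraMap K L))
    (hK : valuation K (ℓ : K) < 1) (hL : valuation L (ℓ : L) < 1)
    (τ'' : @AlgHom ℚ_[ℓ] L (PadicAlgCl ℓ) _ _ _ (fontainePst L ℓ hL).algebra _) :
    ∃ τ' : @AlgHom ℚ_[ℓ] K (PadicAlgCl ℓ) _ _ _ (fontainePst K ℓ hK).algebra _,
      @AlgHom.toRingHom ℚ_[ℓ] K (PadicAlgCl ℓ) _ _ _ (fontainePst K ℓ hK).algebra _ τ' =
        (@AlgHom.toRingHom ℚ_[ℓ] L (PadicAlgCl ℓ) _ _ _ (fontainePst L ℓ hL).algebra _ τ'').comp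
          (algebraMap K L) := by
  letI := (fontainePst L ℓ hL).algebra
  have hcomp := algebraMap_comp_algebraMap_fontainePst hc hK hL
  letI := (fontainePst K ℓ hK).algebra
  refine ⟨{ (τ''.toRingHom.comp (algebraMap K L)) with commutes' := fun q => ?_ }, rfl⟩
  change τ'' (algebraMap K L (algebraMap ℚ_[ℓ] K q)) = algebraMap ℚ_[ℓ] (PadicAlgCl ℓ) q
  have : algebraMap K L (algebraMap ℚ_[ℓ] K q) = algebraMap ℚ_[ℓ] L q :=
    RingHom.congr_fun hcomp q
  rw [this, AlgHom.commutes]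

end Labels

/-! ### Small arithmetic facts -/

section Arithmetic

/-- The pairwise sums `{a+a', a+b', b+a', b+b'}` of `{a < b}` and `{a' < b'}` form a multiset of
cardinality `4`, without repetition as soon as the gaps differ (`b - a ≠ b' - a'`; the only possible
coincidence is `a + b' = b + a'`). [folklore] -/
theorem nodup_and_card_pairSum {a b a' b' : ℤ} (hab : a < b) (hab' : a' < b')
    (hgap : b - a ≠ b' - a') :
    (({a, b} : Multiset ℤ).bind fun x => ({a', b'} : Multiset ℤ).map fun y => x + y).Nodup ∧
      Multiset.card (({a, b} : Multiset ℤ).bind fun x => ({a', b'} : Multiset ℤ).map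
        fun y => x + y) = 4 := by
  constructor
  · simp only [Multiset.insert_eq_cons, Multiset.cons_bind, Multiset.singleton_bind,
      Multiset.map_cons, Multiset.map_singleton, Multiset.cons_add, Multiset.singleton_add,
      Multiset.nodup_cons, Multiset.mem_cons, Multiset.mem_singleton, Multiset.nodup_singleton,
      and_true]
    omega
  · simp

/-- In a group of order two, two non-identity elements coincide. [folklore] -/
theorem eq_of_ne_one_of_card_eq_two {G : Type*} [Group G] (hG : Nat.card G = 2) {s g : G}
    (hs : s ≠ 1) (hg : g ≠ 1) : s = g := by
  obtain ⟨y, -, hy⟩ := (Nat.card_eq_two_iff' (1 : G)).1 hG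
  rw [hy s hs, hy g hg]

end Arithmetic

end Summit.Langlands.Langlands.Theorems.TensorSquareParallel

end
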